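import Summits.AnomalousDissipation.AnomalousDissipation.Theorems.TwoAndHalfDTwohalfdThesisStubDissipationFloor
import Summits.AnomalousDissipation.AnomalousDissipation.Theorems.TwoAndHalfDTwohalfdThesisStubWeakDuhamel

/-!
# H2 `stub_gkLimsupNecessary`: the Green–Kubo clause is necessary in `limsup` form

Stub H2 of the line `Sketch` (duhamel-release) for the crux
`Summit.AnomalousDissipation.AnomalousDissipation.Theses.TwoAndHalfD.TwohalfdThesis`
(stmt-AnomalousDissipation-0206); the statement is registered verbatim in the line's checked
skeleton and is consumed by the kernel-checked composition there.

CONTENT. Let `κ > 0`, let `θ` be the classical cold start (`θ(0) = 0`) of the sourced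
advection–diffusion equation `∂ₜθ + u·∇θ = κΔθ + h` on `[0, ∞) × T²` with bounded variance
`‖θ(t)‖²_{L²} ≤ B` (`t ≥ 0`), and for every `s ≥ 0` let `φ s` be a classical solution of the
unforced equation on `[s, ∞)` released from `φ s s = h`. If the limsup-mean dissipation
`⟨κ‖∇θ‖²⟩ = limsup_T T⁻¹∫₀ᵀ κ‖∇θ(t)‖²` (spectral gradient norm, `toReal`) is `≥ ε`, then so is the
limsup-mean Green–Kubo integral: `ε ≤ limsup_T T⁻¹∫₀ᵀ (∫₀ᵗ ⟪h, φ s (t)⟫ ds) dt`.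

PROOF. (1) The sourced `L²` balance in Cesàro form (`dissipationFloor_timeMean_eq`, D2 toolkit):
`T⁻¹∫₀ᵀ κ‖∇θ‖² = T⁻¹∫₀ᵀ ⟪h, θ⟫ - (‖θ(T)‖² - ‖θ(0)‖²)/(2T)`, so with `‖θ(t)‖² ≤ B` the dissipation
means lie within `B/(2T)` of the power means, and the power means are bounded
(`|⟪h, θ(t)⟫| ≤ ‖h‖√B`, Cauchy–Schwarz). (2) Real-variable bookkeeping
(`gkLimsup_le_limsup_of_limsup_le`): `ε - δ/2 < limsup` dissipation makes the dissipation means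
frequently `> ε - δ/2` (`Filter.frequently_lt_of_lt_limsup`), eventually `B/(2T) < δ/2`, so the
power means are frequently `≥ ε - δ`, whence `ε - δ ≤ limsup` power
(`Filter.le_limsup_of_frequently_le`), every `δ > 0`. (3) The weak Duhamel identity
(`stub_weakDuhamel`, D0, with the test function `χ := h`) rewrites the power as the Green–Kubo
integral, `⟪h, θ(t)⟫ = ∫₀ᵗ ⟪h, φ s (t)⟫ ds` for `t ≥ 0`, and the time means only see `t > 0`
(`timeMean_eventuallyEq`, `Filter.limsup_congr`).
Supports stmt-AnomalousDissipation-0206. [folklore: Doering–Foias 2002, §2 (power balance in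
Cesàro form); Taylor 1921 / Green–Kubo representation of the eddy flux]
-/

noncomputable section

-- the summit path `AnomalousDissipation/AnomalousDissipation` duplicates a namespace component
set_option linter.dupNamespace false

namespace Summit.AnomalousDissipation.AnomalousDissipation.Theorems.TwohalfdThesis

open MeasureTheory Set Filter Topology
open scoped ENNReal NNReal InnerProductSpace
open Literature.Analysis.FunctionSpaces Literature.Analysis.FluidPDE

/-! ## Real-variable bookkeeping: from a limsup floor to a limsup floor -/

/-- **Cesàro bookkeeping (limsup to limsup).** If `m T - B/(2T) ≤ n T ≤ m T + B/(2T)` and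
`|m T| ≤ K` for `T > 0`, `B ≥ 0` and `ε ≤ limsup n`, then `ε ≤ limsup m` (all along `atTop` in
`ℝ`; the two-sided bounds make both `limsup`s honest): for `δ > 0`, frequently `n T > ε - δ/2`
(`Filter.frequently_lt_of_lt_limsup`, `n` being eventually bounded below) and eventually
`B/(2T) < δ/2`, so frequently `m T ≥ ε - δ`, whence `ε - δ ≤ limsup m`
(`Filter.le_limsup_of_frequently_le`, `m` being eventually bounded above). [folklore] -/
theorem gkLimsup_le_limsup_of_limsup_le {m n : ℝ → ℝ} {ε B K : ℝ} (hB : 0 ≤ B)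
    (hlow : ∀ T, 0 < T → m T - B / (2 * T) ≤ n T)
    (hup : ∀ T, 0 < T → n T ≤ m T + B / (2 * T))
    (hm : ∀ T, 0 < T → |m T| ≤ K)
    (hε : ε ≤ limsup n atTop) : ε ≤ limsup m atTop := by
  have hBd : Tendsto (fun T : ℝ => B / (2 * T)) atTop (𝓝 0) :=
    tendsto_const_nhds.div_atTop (tendsto_id.const_mul_atTop two_pos)
  have hm_bdd : IsBoundedUnder (· ≤ ·) atTop m :=
    ⟨K, (eventually_gt_atTop (0 : ℝ)).mono fun T hT => (abs_le.1 (hm T hT)).2⟩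
  have hn_bdd : IsBoundedUnder (· ≥ ·) atTop n := by
    refine ⟨-K - B / 2, (eventually_ge_atTop (1 : ℝ)).mono fun T hT => ?_⟩
    have hT0 : 0 < T := by linarith
    have h1 : B / (2 * T) ≤ B / 2 := div_le_div_of_nonneg_left hB two_pos (by linarith)
    have h2 : -K ≤ m T := (abs_le.1 (hm T hT0)).1
    show -K - B / 2 ≤ n T
    linarith [hlow T hT0]
  have hn_cobdd : IsCoboundedUnder (· ≤ ·) atTop n := hn_bdd.isCoboundedUnder_le
  refine le_of_forall_pos_le_add fun δ hδ => ?_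
  rw [← sub_le_iff_le_add]
  have h1 : ∃ᶠ T in atTop, ε - δ / 2 < n T :=
    frequently_lt_of_lt_limsup hn_cobdd (lt_of_lt_of_le (by linarith) hε)
  have h2 : ∀ᶠ T in atTop, B / (2 * T) < δ / 2 := hBd.eventually_lt_const (half_pos hδ)
  have h3 : ∃ᶠ T in atTop, ε - δ ≤ m T := by
    refine (h1.and_eventually (h2.and (eventually_gt_atTop (0 : ℝ)))).mono fun T hT => ?_
    obtain ⟨hT1, hT2, hT0⟩ := hT
    linarith [hup T hT0]
  exact le_limsup_of_frequently_le h3 hm_bdd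

/-! ## The stub -/

/-- **H2 `stub_gkLimsupNecessary` (line `Sketch` = duhamel-release, crux `TwoAndHalfD.TwohalfdThesis`):
the Green–Kubo clause is NECESSARY in `limsup` form.** For the classical cold start `θ`
(`∂ₜθ + u·∇θ = κΔθ + h` on `[0, ∞) × T²`, `θ(0) = 0`, `κ > 0`, `h` smooth) with bounded variance
`‖θ(t)‖²_{L²} ≤ B` (`t ≥ 0`) and the classical unforced releases `φ s` of `h` (`s ≥ 0`): a
limsup-mean dissipation floor `ε ≤ ⟨κ‖∇θ‖²⟩` forces the limsup-mean Green–Kubo floor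
`ε ≤ limsup_T T⁻¹∫₀ᵀ (∫₀ᵗ ⟪h, φ s (t)⟫ ds) dt`. Proof: the Cesàro-form balance
`dissipationFloor_timeMean_eq` puts the dissipation means within `B/(2T)` of the (bounded,
Cauchy–Schwarz) power means, the bookkeeping `gkLimsup_le_limsup_of_limsup_le` transfers the
`limsup` floor to the power, and the weak Duhamel identity `stub_weakDuhamel` (test function `h`)
identifies the power `⟪h, θ(t)⟫` with `∫₀ᵗ ⟪h, φ s (t)⟫ ds` for `t ≥ 0` (Doering–Foias 2002, §2;
Green–Kubo). [folklore] -/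
theorem stub_gkLimsupNecessary :
    ∀ (κ B ε : ℝ) (u : ℝ → (UnitAddTorus (Fin 2)) → (EuclideanSpace ℝ (Fin 2))) (h : (UnitAddTorus (Fin 2)) → ℝ)
      (θ : ℝ → (UnitAddTorus (Fin 2)) → ℝ) (φ : ℝ → ℝ → (UnitAddTorus (Fin 2)) → ℝ),
      0 < κ → Torus.IsSmooth h →
      Torus.IsClassicalScalarTransportForcedOn (Ici 0) κ u (fun _ => h) θ → θ 0 = (fun _ => (0 : ℝ)) →
      (∀ s, 0 ≤ s → Torus.IsClassicalScalarTransportOn (Ici s) κ u (φ s) ∧ φ s s = h) →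
      (∀ t, 0 ≤ t → Torus.scalarL2Sq (θ t) ≤ B) →
      ε ≤ longTimeAvgSup (fun t => κ * (Torus.eScalarGradNormSq (θ t)).toReal) →
      ε ≤ limsup (timeMean fun t => ∫ s in (0 : ℝ)..t, ∫ x, h x * φ s t x) atTop := by
  intro κ B ε u h θ φ hκ hh hθ hθ0 hφ hB hε
  have hB0 : 0 ≤ B := (Torus.scalarL2Sq_nonneg (θ 0)).trans (hB 0 le_rfl)
  -- Cauchy–Schwarz: the input power is bounded by `‖h‖ √B` on `[0, ∞)`
  have hPle : ∀ t, 0 ≤ t → |∫ x, h x * θ t x| ≤ √(Torus.scalarL2Sq h) * √B := by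
    intro t ht
    have hθt : Torus.IsSmooth (θ t) := hθ.smooth_scalar.isSmooth_slice (mem_Ici.2 ht)
    have h1 := ScalarAnomalySteadySourceFormal.ColdStartVariance.integral_mul_le_sqrt_mul_sqrt
      (hh.memLp 2) (hθt.memLp 2)
    have h2 := ScalarAnomalySteadySourceFormal.ColdStartVariance.integral_mul_le_sqrt_mul_sqrt
      (hh.memLp 2).neg (hθt.memLp 2)
    simp only [Pi.neg_apply, neg_mul, integral_neg, neg_sq] at h2
    have h3 : √(∫ x, h x ^ 2) * √(∫ x, θ t x ^ 2) ≤ √(Torus.scalarL2Sq h) * √B :=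
      mul_le_mul_of_nonneg_left (Real.sqrt_le_sqrt (hB t ht)) (Real.sqrt_nonneg _)
    rw [abs_le]
    exact ⟨by linarith, by linarith⟩
  have hm : ∀ T, 0 < T →
      |timeMean (fun t => ∫ x, h x * θ t x) T| ≤ √(Torus.scalarL2Sq h) * √B :=
    fun T hT => abs_timeMean_le hT fun t ht _ => hPle t ht.le
  -- the Cesàro-form balance, bounded variance: the dissipation means are within `B/(2T)` of the
  -- power means
  have hlow : ∀ T, 0 < T → timeMean (fun t => ∫ x, h x * θ t x) T - B / (2 * T) ≤
      timeMean (fun t => κ * (Torus.eScalarGradNormSq (θ t)).toReal) T := by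
    intro T hT
    rw [dissipationFloor_timeMean_eq hθ hT]
    have h1 : Torus.scalarL2Sq (θ T) - Torus.scalarL2Sq (θ 0) ≤ B := by
      linarith [hB T hT.le, Torus.scalarL2Sq_nonneg (θ 0)]
    have h2 : (Torus.scalarL2Sq (θ T) - Torus.scalarL2Sq (θ 0)) / (2 * T) ≤ B / (2 * T) :=
      div_le_div_of_nonneg_right h1 (by positivity)
    linarith
  have hup : ∀ T, 0 < T → timeMean (fun t => κ * (Torus.eScalarGradNormSq (θ t)).toReal) T ≤
      timeMean (fun t => ∫ x, h x * θ t x) T + B / (2 * T) := by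
    intro T hT
    rw [dissipationFloor_timeMean_eq hθ hT]
    have h1 : Torus.scalarL2Sq (θ 0) - Torus.scalarL2Sq (θ T) ≤ B := by
      linarith [hB 0 le_rfl, Torus.scalarL2Sq_nonneg (θ T)]
    have h2 : (Torus.scalarL2Sq (θ 0) - Torus.scalarL2Sq (θ T)) / (2 * T) ≤ B / (2 * T) :=
      div_le_div_of_nonneg_right h1 (by positivity)
    have h4 : (Torus.scalarL2Sq (θ 0) - Torus.scalarL2Sq (θ T)) / (2 * T) =
        -((Torus.scalarL2Sq (θ T) - Torus.scalarL2Sq (θ 0)) / (2 * T)) := by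
      ring
    linarith
  -- the `limsup` floor passes from the dissipation to the power
  have hεP : ε ≤ limsup (timeMean fun t => ∫ x, h x * θ t x) atTop :=
    gkLimsup_le_limsup_of_limsup_le hB0 hlow hup hm hε
  -- weak Duhamel: the power is the Green–Kubo integral for `t ≥ 0`
  have heq : ∀ t, 0 < t → (∫ x, h x * θ t x) = ∫ s in (0 : ℝ)..t, ∫ x, h x * φ s t x := by
    intro t ht
    have hD := stub_weakDuhamel κ u h θ φ hκ hh hθ hθ0 hφ h hh t ht.le
    calc (∫ x, h x * θ t x) = ∫ x, θ t x * h x :=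
          integral_congr_ae (Eventually.of_forall fun x => mul_comm _ _)
      _ = ∫ s in (0 : ℝ)..t, ∫ x, φ s t x * h x := hD
      _ = ∫ s in (0 : ℝ)..t, ∫ x, h x * φ s t x :=
          intervalIntegral.integral_congr fun s _ =>
            integral_congr_ae (Eventually.of_forall fun x => mul_comm _ _)
  rwa [limsup_congr (timeMean_eventuallyEq heq)] at hεP

end Summit.AnomalousDissipation.AnomalousDissipation.Theorems.TwohalfdThesis

end
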